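import Mathlib
import Summits.ValiantsHypothesis.ValiantsHypothesis.Theses.ElementaryWordLength
import Summits.ValiantsHypothesis.ValiantsHypothesis.Theorems.ElementaryWordLengthWordToFormula
import Literature.Computability.AlgebraicComplexity.NewtonPolygonTauTransfer
import Literature.Computability.AlgebraicComplexity.NewtonPolygonTauProofs
import Literature.Computability.AlgebraicComplexity.CircuitDepthProofs
import Literature.Computability.AlgebraicComplexity.ValiantConjectureEquivProofs

/-!
# Crux `WordPerSuperPoly` (stmt-ValiantsHypothesis-6626), line `Sketch` — the crux from the Newton-polygon τ-conjecture

Supports `Summit.ValiantsHypothesis.ValiantsHypothesis.Theses.ElementaryWordLength.WordPerSuperPoly`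
(route `ElementaryWordLength`), line `Sketch` (card `newton-shadow-word-tau`). The line's own open
stub S2 (`stub_cancellationSubexp`, the word Newton-τ statement) is one Newton-polygon hypothesis
that gives the crux (`Theorems/ElementaryWordLengthWordPerSuperPolyConditional.lean`); this file
records the cheaper and more quotable bridge through the PUBLISHED conjecture already in the tree:

* `WordPerSuperPoly_of_not_isPComputable_per`: if the permanent family is not p-computable over
  `ℂ`, then `WordPerSuperPoly` — polynomial-length affine elementary words for `E_13(per_n)` are
  fan-in-two formulas of size `≤ 20 (L+1)^3` (the landed route support `wordToFormula_proof`,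
  Ben-Or–Cleve's converse direction) and formulas are circuits (`complexity_le_formulaComplexity_holds`),
  so they would make `L(per_n)` p-bounded.
* `WordPerSuperPoly_of_newtonTauWeak`: the weak Newton-polygon τ-conjecture of
  Koiran–Portier–Tavenas–Thomassé (KPTT 2015, `KPTT.newtonTauWeak`, `@[conjecture]`, NOT asserted)
  implies `WordPerSuperPoly`, via KPTT's Theorem 1 PROVED in the tree (`KPTT.theorem1_holds`:
  `newtonTauWeak → PER ∉ VP_ℂ`).
* `WordPerSuperPoly_of_newtonTauConjecture`: hence so does KPTT's Conjecture 1 (polynomial form).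
* `WordPerSuperPoly_of_valiantsHypothesis`: the summit statement `ValiantsHypothesis`
  (`VP_ℂ ≠ VNP_ℂ`) implies the crux (`perNotPComputableComplex_iff_holds`): the crux is a genuine
  MILESTONE — necessary for the summit — exactly as the route's planner recorded ("weaker than X").

All four are sorry-free conditional theorems; their hypotheses are open statements taken as
explicit antecedents, never asserted.
-/

-- `Summit.ValiantsHypothesis.ValiantsHypothesis.…` is the tree's mandated single-conjunct layout.
set_option linter.dupNamespace false

namespace Summit.ValiantsHypothesis.ValiantsHypothesis.Theorems.ElementaryWordLengthWordPerSuperPoly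

open MvPolynomial Literature.Computability.AlgebraicComplexity

/-- The size bound `20 ((n^c + c) + 1)^3` of the formulas obtained from words of length
`≤ n^c + c` is a p-bounded function of `n`. [folklore] -/
theorem isPBounded_wordFormulaSize (c : ℕ) :
    IsPBounded fun n : ℕ => 20 * (n ^ c + c + 1) ^ 3 := by
  have h1 : IsPBounded fun n : ℕ => n ^ c := IsPBounded.pow_holds IsPBounded.id c
  have h2 : IsPBounded fun n : ℕ => n ^ c + c + 1 :=
    IsPBounded.add_holds (IsPBounded.add_holds h1 (IsPBounded.const c)) (IsPBounded.const 1)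
  exact IsPBounded.mul_holds (IsPBounded.const 20) (IsPBounded.pow_holds h2 3)

/-- **Words of polynomial length would make the permanent p-computable.** If `(per_n)_n` is not
p-computable over `ℂ` (`¬ IsPComputable`, i.e. `L(per_n)` is not p-bounded), then for every `c`
some `E_13(per_n)` has no affine elementary word of length `≤ n^c + c`: such a word is a fan-in-two
formula of size `≤ 20 (n^c + c + 1)^3` for `per_n` (`wordToFormula_proof`, Ben-Or–Cleve 1992 §3 /
BCS 1997 Rem. (21.34)), and `L ≤ E` (`complexity_le_formulaComplexity_holds`).
[conditional on an open hypothesis, stated inline] -/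
theorem WordPerSuperPoly_of_not_isPComputable_per
    (hper : ¬ IsPComputable (fun n => perPoly (Fin n) ℂ)) :
    Summit.ValiantsHypothesis.ValiantsHypothesis.Theses.ElementaryWordLength.WordPerSuperPoly := by
  intro c
  by_contra hall
  push Not at hall
  apply hper
  refine (isPBounded_wordFormulaSize c).mono fun n => ?_
  obtain ⟨w, hlen, hne, hprod⟩ := hall n
  calc complexity (perPoly (Fin n) ℂ) ≤ formulaComplexity (perPoly (Fin n) ℂ) :=
        complexity_le_formulaComplexity_holds _
    _ ≤ 20 * (n ^ c + c + 1) ^ 3 :=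
        Theorems.ElementaryWordLength.wordToFormula_proof (perPoly (Fin n) ℂ) (n ^ c + c)
          ⟨w, hlen, hne, hprod⟩

/-- **The weak Newton-polygon τ-conjecture implies `WordPerSuperPoly`.** KPTT 2015's "for
instance" bound — `#vert Newt(Σ_{i<k} Π_{j<m} f_ij) ≤ 2^{a m} (k t + 2)^b` for `t`-sparse bivariate
`f_ij` over `ℂ` (`KPTT.newtonTauWeak`, an OPEN conjecture, taken as hypothesis) — puts the permanent
outside `VP_ℂ` by KPTT's Theorem 1, PROVED in the tree (`KPTT.theorem1_holds`); in particular
`(per_n)` is not p-computable, so `E_13(per_n)` has no polynomial-length affine elementary words.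
[cite: KoiranPortierTavenasThomasse2015, Theorem 1] [conditional on an open hypothesis, stated inline] -/
theorem WordPerSuperPoly_of_newtonTauWeak (h : KPTT.newtonTauWeak) :
    Summit.ValiantsHypothesis.ValiantsHypothesis.Theses.ElementaryWordLength.WordPerSuperPoly :=
  WordPerSuperPoly_of_not_isPComputable_per fun hPC =>
    KPTT.theorem1_holds h ⟨isPFamily_perPoly_holds, hPC⟩

/-- **The Newton-polygon τ-conjecture (KPTT 2015, Conjecture 1) implies `WordPerSuperPoly`**, via its
weak form (`KPTT.newtonTauWeak_of_newtonTauConjecture`). The conjecture is OPEN and taken as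
hypothesis. [cite: KoiranPortierTavenasThomasse2015, Conjecture 1 and Theorem 1]
[conditional on an open hypothesis, stated inline] -/
theorem WordPerSuperPoly_of_newtonTauConjecture (h : KPTT.newtonTauConjecture) :
    Summit.ValiantsHypothesis.ValiantsHypothesis.Theses.ElementaryWordLength.WordPerSuperPoly :=
  WordPerSuperPoly_of_newtonTauWeak (KPTT.newtonTauWeak_of_newtonTauConjecture h)

/-- **The crux is a milestone of the summit: `ValiantsHypothesis → WordPerSuperPoly`.** Valiant's
hypothesis `VP_ℂ ≠ VNP_ℂ` is equivalent to the permanent family not being p-computable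
(`perNotPComputableComplex_iff_holds`; von zur Gathen 1987 Prop. 4.8, Bürgisser 2000 Rem. 2.11),
whence the crux by `WordPerSuperPoly_of_not_isPComputable_per`. (So the crux is NECESSARY for the
summit; the route uses it only as a milestone, the thesis being the stronger `WordLengthQP`.)
[conditional on the summit statement, stated inline] -/
theorem WordPerSuperPoly_of_valiantsHypothesis (h : ValiantsHypothesis) :
    Summit.ValiantsHypothesis.ValiantsHypothesis.Theses.ElementaryWordLength.WordPerSuperPoly :=
  WordPerSuperPoly_of_not_isPComputable_per (perNotPComputableComplex_iff_holds.2 h)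

end Summit.ValiantsHypothesis.ValiantsHypothesis.Theorems.ElementaryWordLengthWordPerSuperPoly
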